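import Summits.HubbardSuperconductivity.HubbardSuperconductivity.Theorems.AnisotropyChordTransferFibre3FinX3Eval

/-!
# Route `AnisotropyChord` / H0 rotor rung: FIN per-`L` GM₃ (X5), `L = 29` — rows `N₁` / D / side-condition cell facts, part `p47`

Kernel facts (`decide +kernel`) for cert cells 114, 115 of the per-`L` grid of `L = 29`: `xbnCellAny2` (row `N₁` on XB2 point wedges recomputed in the kernel, exporting the literal brackets `nt ⊇ T⁺ − 3λ₂` and `tb ⊇ T⁺·D`), `xdCellAnyN0` (row D, reads `nt`), `sdCellAnyZN` (side condition, reads `nt`); evaluators `…FinX3Eval` / `…FinX5Eval`; constants from the compiled design probe (x3probe/x3plan, margins c ×0.985, b ×1.03, aD ×1.03); assembled in `…FinX5GM3TwentyNine`.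
Prover seat `hubbard-h0-rotor-p3` g8; helper for piece A = stmt-HubbardSuperconductivity-23918 of rung 19089 (`--supports`, helper class).
WHAT THIS IS NOT: nothing here proves superconductivity in the Hubbard model (rotor TARGET as worded stays FALSE, g15 verdict); kernel facts for the FIN certificate of ONE conditional reduction.  Tree imports only; zero data; standard axioms.
-/

set_option linter.dupNamespace false
set_option autoImplicit false

namespace Summit.HubbardSuperconductivity.HubbardSuperconductivity.Theorems.AnisotropyChord.Transfer.Fibre3

namespace FinXD

open FinXB FinCell Hole2

set_option maxHeartbeats 4000000 in
/-- row `N₁` of cell 114 of `L = 29` (`c = 117/200`), exporting `nt`, `tb`. [folklore] -/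
theorem xn29_114 : xbnCellAny2 29 (49/50 : ℚ) 1035512142881653 1061399946453695 (117/200 : ℚ) ((9089642105852 : ℤ), (15398121420993 : ℤ)) ((3115607109957179 : ℤ), (3199616921575710 : ℤ)) = true := by decide +kernel

set_option maxHeartbeats 4000000 in
/-- row D of cell 114 of `L = 29` (`aD = 79/1000`). [folklore] -/
theorem xd29_114 : xdCellAnyN0 29 (49/50 : ℚ) 1035512142881653 1061399946453695 (79/1000 : ℚ) ((9089642105852 : ℤ), (15398121420993 : ℤ)) = true := by decide +kernel

set_option maxHeartbeats 4000000 in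
/-- side condition of cell 114 of `L = 29` (`c, b = 87/100, aD`). [folklore] -/
theorem sd29_114 : sdCellAnyZN 29 (49/50 : ℚ) 100 1035512142881653 1061399946453695 ((117/200 : ℚ), (87 : ℕ), (79/1000 : ℚ)) ((9089642105852 : ℤ), (15398121420993 : ℤ)) = true := by decide +kernel

set_option maxHeartbeats 4000000 in
/-- row `N₁` of cell 115 of `L = 29` (`c = 117/200`), exporting `nt`, `tb`. [folklore] -/
theorem xn29_115 : xbnCellAny2 29 (49/50 : ℚ) 1061399946453695 1087934945115038 (117/200 : ℚ) ((9841682865500 : ℤ), (16385590636028 : ℤ)) ((3194022087413113 : ℤ), (3280209860794614 : ℤ)) = true := by decide +kernel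

set_option maxHeartbeats 4000000 in
/-- row D of cell 115 of `L = 29` (`aD = 79/1000`). [folklore] -/
theorem xd29_115 : xdCellAnyN0 29 (49/50 : ℚ) 1061399946453695 1087934945115038 (79/1000 : ℚ) ((9841682865500 : ℤ), (16385590636028 : ℤ)) = true := by decide +kernel

set_option maxHeartbeats 4000000 in
/-- side condition of cell 115 of `L = 29` (`c, b = 88/100, aD`). [folklore] -/
theorem sd29_115 : sdCellAnyZN 29 (49/50 : ℚ) 100 1061399946453695 1087934945115038 ((117/200 : ℚ), (88 : ℕ), (79/1000 : ℚ)) ((9841682865500 : ℤ), (16385590636028 : ℤ)) = true := by decide +kernel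

end FinXD

end Summit.HubbardSuperconductivity.HubbardSuperconductivity.Theorems.AnisotropyChord.Transfer.Fibre3
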